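import Mathlib
import Summits.ValiantsHypothesis.ValiantsHypothesis.Theorems.NewtonUnitEquationsTwoProductsRaySeries
import Summits.ValiantsHypothesis.ValiantsHypothesis.Theorems.NewtonUnitEquationsTwoProductsFormalLogLinearisationDefs

/-!
# Crux `TwoProducts` (stmt-ValiantsHypothesis-5906), line `formal-log-linearisation`: STUB 4 `stub_raysRung`

The registered line `Cruxes/TwoProducts/Lines/formal-log-linearisation.lean` (NOT the item's skeleton of record)
reduces the crux `TwoProducts` to a count of weight-visible points of the support of the log-sum
`D = Σ_j log (1 + u_j) − Σ_j log (1 + v_j)` of a normalised instance.  Its STUB 4 (`stub_raysRung`, "M, provable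
now"; Disproof F3, card (ii)) is the MONOMIAL-TAIL rung: if every tail `u_j`, `v_j` has at most one monomial, any
finite set of visible points of `supp D` (the line's `logVisible`) has at most `2m` elements.  This file proves it
VERBATIM over the objects of `Theorems/NewtonUnitEquationsTwoProductsFormalLogLinearisationDefs.lean` (= the line's
objects, same names and bodies).

## Proof

With `u_j = c_j X^{e_j}` (landed `TwoProducts.RaySeries.exists_eq_monomial_of_card_support_le_one`), the line's
`logCoeff (u_j)` is supported on the ray `ℕ • e_j` (`u_j ^ r = c_j^r X^{r e_j}`), so every point of `supp D` lies on
one of the `≤ 2m` rays spanned by the tail exponents (`exists_ray_of_mem_logSupport`).  Two visible points on the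
ray of the SAME tail coincide (`eq_of_visible_on_ray`): each is the strict top for some valid weight, valid weights
are negative on the tail, so each would have to be strictly nearer to the origin than the other.  Hence
`S ⊆ ⋃_{x : Fin m ⊕ Fin m} (S ∩ ray x)` with every piece of size `≤ 1`, and `#S ≤ 2m` (no choice function, so the
case `m = 0` needs no separate treatment).

Honest framing: a bookkeeping rung of a registered non-record line; the line's open engine `stub_logSumEngine` and
the crux `TwoProducts` are untouched and OPEN; nothing here bears on `VP ≠ VNP`.
-/

set_option linter.dupNamespace false

noncomputable section

open scoped BigOperators
open MvPolynomial

namespace Summit.ValiantsHypothesis.ValiantsHypothesis.Theorems.NewtonUnitEquations.TwoProducts.FormalLogLinearisation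

variable {m : ℕ}

/-- The real weight is homogeneous along rays: `wt ξ (r • e) = r · wt ξ e`. [folklore] -/
theorem wt_nsmul (ξ : Fin 2 → ℝ) (r : ℕ) (e : Expo) : wt ξ (r • e) = (r : ℝ) * wt ξ e := by
  simp only [wt, Finsupp.coe_smul, Pi.smul_apply, smul_eq_mul, Nat.cast_mul]
  ring

/-- A nonzero coefficient of a power `p ^ r`, `r ≥ 1`, of a polynomial with at most one monomial sits at `r • e`
for the support point `e` of `p`. [folklore] -/
theorem exists_eq_nsmul_of_coeff_pow_ne_zero (p : MvPolynomial (Fin 2) ℂ) (hp : p.support.card ≤ 1) (r : ℕ)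
    (hr : 1 ≤ r) (l : Expo) (h : coeff l (p ^ r) ≠ 0) : ∃ e ∈ p.support, l = r • e := by
  classical
  obtain ⟨g, c, rfl⟩ := TwoProducts.RaySeries.exists_eq_monomial_of_card_support_le_one p hp
  rw [monomial_pow, coeff_monomial] at h
  split_ifs at h with hg
  · have hc : c ≠ 0 := by
      rintro rfl
      exact h (zero_pow (by omega))
    refine ⟨g, ?_, hg.symm⟩
    rw [support_monomial, if_neg hc]
    exact Finset.mem_singleton_self g
  · exact absurd rfl h

/-- For monomial tails, a nonzero log-coefficient `logCoeff u l ≠ 0` forces `l` onto the ray of the tail exponent.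
[folklore] -/
theorem exists_eq_nsmul_of_logCoeff_ne_zero (p : MvPolynomial (Fin 2) ℂ) (hp : p.support.card ≤ 1) (l : Expo)
    (h : logCoeff p l ≠ 0) : ∃ r : ℕ, ∃ e ∈ p.support, l = r • e := by
  classical
  unfold logCoeff at h
  obtain ⟨r, hr, hne⟩ := Finset.exists_ne_zero_of_sum_ne_zero h
  have hr1 : 1 ≤ r := (Finset.mem_Icc.mp hr).1
  have hcoeff : coeff l (p ^ r) ≠ 0 := fun h0 => hne (by rw [h0, mul_zero])
  obtain ⟨e, he, hl⟩ := exists_eq_nsmul_of_coeff_pow_ne_zero p hp r hr1 l hcoeff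
  exact ⟨r, e, he, hl⟩

/-- For monomial tails every point of `supp D` lies on the ray of some tail exponent (indexed by
`Fin m ⊕ Fin m`: left = a `u`-tail, right = a `v`-tail). [folklore] -/
theorem exists_ray_of_mem_logSupport (u v : Fin m → MvPolynomial (Fin 2) ℂ) (hu : ∀ j, (u j).support.card ≤ 1)
    (hv : ∀ j, (v j).support.card ≤ 1) (l : Expo) (hl : l ∈ logSupport u v) :
    ∃ x : Fin m ⊕ Fin m, Sum.elim (fun j => ∃ r : ℕ, ∃ e ∈ (u j).support, l = r • e)
      (fun j => ∃ r : ℕ, ∃ e ∈ (v j).support, l = r • e) x := by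
  classical
  have hl' : logDiff u v l ≠ 0 := hl
  unfold logDiff at hl'
  by_contra hbad
  push Not at hbad
  have hU : ∀ j, logCoeff (u j) l = 0 := by
    intro j
    by_contra hne
    obtain ⟨r, e, he, hle⟩ := exists_eq_nsmul_of_logCoeff_ne_zero (u j) (hu j) l hne
    exact hbad (Sum.inl j) ⟨r, e, he, hle⟩
  have hV : ∀ j, logCoeff (v j) l = 0 := by
    intro j
    by_contra hne
    obtain ⟨r, e, he, hle⟩ := exists_eq_nsmul_of_logCoeff_ne_zero (v j) (hv j) l hne
    exact hbad (Sum.inr j) ⟨r, e, he, hle⟩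
  exact hl' (by rw [Finset.sum_eq_zero fun j _ => hU j, Finset.sum_eq_zero fun j _ => hV j, sub_self])

/-- Two VISIBLE points of `supp D` on the ray of one tail exponent coincide: each is the strict top for a valid
weight, which is negative on the tail, so each would have to be nearer to the origin than the other. [folklore] -/
theorem eq_of_visible_on_ray (u v : Fin m → MvPolynomial (Fin 2) ℂ) (e : Expo)
    (he : ∀ ξ : Fin 2 → ℝ, ValidWeight u v ξ → wt ξ e < 0) (r₁ r₂ : ℕ)
    (h₁ : r₁ • e ∈ logVisible u v) (h₂ : r₂ • e ∈ logVisible u v) : r₁ • e = r₂ • e := by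
  by_contra hne
  obtain ⟨ξ₁, hξ₁, hl₁, hmin₁⟩ := h₁
  obtain ⟨ξ₂, hξ₂, hl₂, hmin₂⟩ := h₂
  have lt₁ := hmin₁ (r₂ • e) hl₂ (Ne.symm hne)
  have lt₂ := hmin₂ (r₁ • e) hl₁ hne
  rw [wt_nsmul, wt_nsmul] at lt₁ lt₂
  have w₁ := he ξ₁ hξ₁
  have w₂ := he ξ₂ hξ₂
  -- from `r₂ w₁ < r₁ w₁` with `w₁ < 0`: `r₁ < r₂`; symmetrically `r₂ < r₁`
  have h12 : (r₁ : ℝ) < r₂ := lt_of_mul_lt_mul_of_nonpos_right lt₁ w₁.le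
  have h21 : (r₂ : ℝ) < r₁ := lt_of_mul_lt_mul_of_nonpos_right lt₂ w₂.le
  exact lt_asymm h12 h21

/-- **STUB 4 of line `formal-log-linearisation` (`stub_raysRung`), verbatim** — the rays rung: for monomial tails,
any finite set of visible points of `supp D` has at most `2m` elements. [folklore] -/
theorem stub_raysRung :
    ∀ (m : ℕ) (u v : Fin m → MvPolynomial (Fin 2) ℂ),
      (∀ j, coeff 0 (u j) = 0 ∧ (u j).support.card ≤ 1) → (∀ j, coeff 0 (v j) = 0 ∧ (v j).support.card ≤ 1) →
        ∀ S : Finset Expo, (↑S ⊆ logVisible u v) → S.card ≤ 2 * m := by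
  classical
  intro m u v hu hv S hS
  -- the ray classes of `S`
  set P : Fin m ⊕ Fin m → Expo → Prop := fun x l => Sum.elim (fun j => ∃ r : ℕ, ∃ e ∈ (u j).support, l = r • e)
    (fun j => ∃ r : ℕ, ∃ e ∈ (v j).support, l = r • e) x with hP
  -- (a) cover: every point of `S` lies in some ray class
  have hcover : S ⊆ Finset.univ.biUnion fun x => S.filter (P x) := by
    intro l hl
    have hlv : l ∈ logVisible u v := hS (Finset.mem_coe.mpr hl)
    obtain ⟨ξ, -, hls, -⟩ := hlv
    obtain ⟨x, hx⟩ := exists_ray_of_mem_logSupport u v (fun j => (hu j).2) (fun j => (hv j).2) l hls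
    exact Finset.mem_biUnion.mpr ⟨x, Finset.mem_univ x, Finset.mem_filter.mpr ⟨hl, hx⟩⟩
  -- (b) each ray class of `S` has at most one element
  have hone : ∀ x : Fin m ⊕ Fin m, (S.filter (P x)).card ≤ 1 := by
    intro x
    refine Finset.card_le_one.mpr fun l₁ hl₁ l₂ hl₂ => ?_
    obtain ⟨hS₁, hP₁⟩ := Finset.mem_filter.mp hl₁
    obtain ⟨hS₂, hP₂⟩ := Finset.mem_filter.mp hl₂
    have hv₁ : l₁ ∈ logVisible u v := hS (Finset.mem_coe.mpr hS₁)
    have hv₂ : l₂ ∈ logVisible u v := hS (Finset.mem_coe.mpr hS₂)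
    cases x with
    | inl j =>
      obtain ⟨r₁, e₁, he₁, rfl⟩ := hP₁
      obtain ⟨r₂, e₂, he₂, rfl⟩ := hP₂
      have hee : e₁ = e₂ := Finset.card_le_one.mp (hu j).2 e₁ he₁ e₂ he₂
      subst hee
      exact eq_of_visible_on_ray u v e₁ (fun ξ hξ => hξ.1 j e₁ he₁) r₁ r₂ hv₁ hv₂
    | inr j =>
      obtain ⟨r₁, e₁, he₁, rfl⟩ := hP₁
      obtain ⟨r₂, e₂, he₂, rfl⟩ := hP₂
      have hee : e₁ = e₂ := Finset.card_le_one.mp (hv j).2 e₁ he₁ e₂ he₂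
      subst hee
      exact eq_of_visible_on_ray u v e₁ (fun ξ hξ => hξ.2 j e₁ he₁) r₁ r₂ hv₁ hv₂
  -- (c) count
  calc S.card ≤ (Finset.univ.biUnion fun x => S.filter (P x)).card := Finset.card_le_card hcover
    _ ≤ ∑ x : Fin m ⊕ Fin m, (S.filter (P x)).card := Finset.card_biUnion_le
    _ ≤ ∑ _x : Fin m ⊕ Fin m, 1 := Finset.sum_le_sum fun x _ => hone x
    _ = 2 * m := by simp [two_mul]

end Summit.ValiantsHypothesis.ValiantsHypothesis.Theorems.NewtonUnitEquations.TwoProducts.FormalLogLinearisation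

end
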